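import Summits.QuantumAdvantage.QuantumAdvantage.Theorems.CubicForrelationNearExactIsExactFourModSixSecondTypeO
import Summits.QuantumAdvantage.QuantumAdvantage.Theorems.CubicForrelationNearExactIsExactFourModSixSecondLevelThree
import Summits.QuantumAdvantage.QuantumAdvantage.Theorems.CubicForrelationNearExactIsExactFourModSixSecondLevelFour
import Summits.QuantumAdvantage.QuantumAdvantage.Theorems.CubicForrelationNearExactIsExactFourModSixSecondSplitA
import Summits.QuantumAdvantage.QuantumAdvantage.Theorems.CubicForrelationNearExactIsExactFourModSixSecondSplitB
import Summits.QuantumAdvantage.QuantumAdvantage.Theorems.CubicForrelationNearExactIsExactFourModSixSecondSplitC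
import Summits.QuantumAdvantage.QuantumAdvantage.Theorems.CubicForrelationNearExactIsExactSixteenBoundary
import Summits.QuantumAdvantage.QuantumAdvantage.Theorems.CubicForrelationNearExactIsExactZeroModSixSecondBoundary

/-!
# Crux `CubicForrelation.NearExactIsExact` (stmt-QuantumAdvantage-14043) — for EVERY `n ≡ 4 (mod 6)`, `n ≥ 22`:
  `Φ ≥ 1 − 2^{−⌊n/3⌋} ⇒ Φ = 1`, i.e. `θ_n < 1 − 2^{−⌊n/3⌋}` (the SECOND dyadic boundary is not attained)

Certificate seat `b2b-cforr-cert` (gen 8).  HONEST FRAMING: a theorem uniform in `n` over the residue class `n ≡ 4 (mod 6)` — infinitely many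
finite-slice verdicts at once; NOT summit progress (the constants `1 − 2^{−⌊n/3⌋}` tend to `1`, while the crux asks for ONE `θ < 1`).  It DOUBLES
the excluded window of the tree's `isolation_rate_closed_four_mod_six` (`1 − 2^{−⌊n/3⌋−1}`, gen 6) on this class; the case `n = 16` (`r = 2`) is
the tree's `isolation_sixteen_closed` (gens 4/6, twelve files), of which this is the general-`r` version; NEW rows: `θ₂₂ < 127/128` (tree:
`< 255/256`), `θ₂₈ < 511/512` (tree: `< 1023/1024`), …

On `n = 6r+4` bits write `W_g = 2^{2r+2}u` (Ax); `d₀ = [u odd]` is affine.  With `s = (−1)^f`, `τ = u − 2^r s`, the budget is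
`Σ τ² = 2^{8r+5}(1−Φ) ≤ 2^{6r+4} = N` at `Φ ≥ 1 − 2^{−(2r+1)}` and the pairing `Σ_y (−1)^g τ̂(y) = 2^{10r+6}(1−Φ) = 2^{2r+1}N`:
* type O (all `u` odd): `f2_typeO_false` (`…FourModSixSecondTypeO`: `τ = (−1)^{d₁}`, `d₁` quadratic; symplectic extraction vs `16 ∣ Σ₆τ`, or
  large radical vs pairing);
* split (`d₀` non-constant): `f2_split_trichotomy` (`…FourModSixSecondSplitBudget`; digits `…FourModSixDigits`, residual `…FourModSixResidual`)
  and the three configurations `f2_splitA_false` / `f2_splitB_false` / `f2_splitC_false`;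
* all `u` even: level `2r+3` `f2_levelThree_false` (codim-2 flat), level `2r+4` `f2_levelFour_false` (codim-4 flat), levels `≥ 2r+5`
  `f2_high_levels` (walk + Hou).
Hence `f2_isolation_ge` (`r ≥ 3`) and, at the literal type `Fin n`, `isolation_closed_four_mod_six_sharp`, `theta_lt_sharp_four_mod_six`,
`theta_halfopen_four_mod_six_sharp` (`θ_n ∈ [15/16, 1 − 2^{−⌊n/3⌋})`), and the explicit rows `isolation_twentytwo_closed` (`127/128`),
`theta_twentytwo_halfopen`, `isolation_twentyeight_closed` (`511/512`).  UNION with the `n ≡ 0 (mod 6)` theorem of this generation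
(`isolation_closed_zero_mod_six_sharp`) and the tree's `isolation_sixteen_closed`: `isolation_closed_sharp_zero_or_four_mod_six` — for every
`n ≥ 16` with `n ≡ 0` or `4 (mod 6)`, `Φ ≥ 1 − 2^{−⌊n/3⌋} ⇒ Φ = 1`.  (At `n = 10` the value `1 − 2^{−⌊n/3⌋} = 7/8` IS attained, `theta_ten_isLeast`;
for `n ≡ 2 (mod 6)` only the rate `1 − 2^{−⌊n/3⌋−1}` is known — the type-O digit `d₁` is quadratic there and the budget is not exhausted.)

References: J. Ax (1964) / R. J. McEliece (1972); X.-D. Hou (1998); MacWilliams–Sloane (1977) Ch. 13–15; R. O'Donnell (2014) §3.3.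
Everything below is proved from Mathlib and the tree; axioms are the standard three.
-/

set_option linter.dupNamespace false -- D-0017: single-problem summit ⇒ `QuantumAdvantage.QuantumAdvantage` by design

noncomputable section

namespace Summit.QuantumAdvantage.QuantumAdvantage.Theorems.CubicForrelation.NearExactIsExact

open Finset
open Literature.Computability.QuantumComplexity
open Literature.Computability.QuantumComplexity.DerivativeWalsh (W)

/-- **`Φ ≥ 1 − 2^{−(2r+1)} ⇒ Φ = 1` for cubic pairs on `(3r+2) + (3r+2)` bits, every `r ≥ 3`.**  Type O: `f2_typeO_false`; split:
`f2_split_trichotomy` + `f2_splitA/B/C_false`; even: `f2_levelThree_false`, `f2_levelFour_false`, `f2_high_levels`.  Uniform in `r`; NOT summit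
progress. [this work] -/
theorem f2_isolation_ge (r : ℕ) (hr : 3 ≤ r) (f g : (Fin ((3 * r + 2) + (3 * r + 2)) → Bool) → Bool) (hf : IsDegLeFun 3 f)
    (hg : IsDegLeFun 3 g) (hΦ : 1 - (1 / 2 : ℝ) ^ (2 * r + 1) ≤ forrelation f g) : forrelation f g = 1 := by
  obtain ⟨u, hu⟩ := tw_base g hg (2 * r + 2) (by omega)
  by_cases hodd : ∃ x, Odd (u x)
  · by_cases heven : ∃ x, ¬ Odd (u x)
    · exfalso
      obtain ⟨hTeq, hpt, hcases⟩ := f2_split_trichotomy r f g u hr hg hu hodd heven hΦ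
      rcases hcases with ⟨hA, hB, hC⟩ | ⟨hA, hB, hC⟩ | ⟨hA, hB, hC⟩
      · exact f2_splitA_false r hr f g hf hg u hu hodd heven hTeq hpt hA hB hC
      · exact f2_splitB_false r hr f g hf hg u hu hodd heven hTeq hpt hA hB hC
      · exact f2_splitC_false r hr f g hf hg u hu hodd heven hTeq hpt hA hB hC
    · push Not at heven
      exact (f2_typeO_false r (by omega) f g hf hg u hu heven hΦ).elim
  · push Not at hodd
    have hu1 := tw_level_up g u hu hodd
    by_cases hodd1 : ∃ x, Odd (u x / 2)
    · exact (f2_levelThree_false r (by omega) f g hf hg _ hu1 hodd1 hΦ).elim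
    · push Not at hodd1
      have hu2 := tw_level_up g _ hu1 hodd1
      by_cases hodd2 : ∃ x, Odd (u x / 2 / 2)
      · exact (f2_levelFour_false r hr f g hf hg _ hu2 hodd2 hΦ).elim
      · push Not at hodd2
        have hu3 := tw_level_up g _ hu2 hodd2
        exact f2_high_levels r hr f g hf hg _ hu3 hΦ

/-- **For every `n ≡ 4 (mod 6)`, `n ≥ 22`, and all cubic `f, g : 𝔽₂ⁿ → 𝔽₂: `Φ(f,g) ≥ 1 − 2^{−⌊n/3⌋} ⇒ Φ(f,g) = 1`** (at the literal
type `Fin n`).  Doubles the excluded window of `isolation_rate_closed_four_mod_six` on this class (`n = 16` is `isolation_sixteen_closed`).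
Infinitely many finite-slice verdicts; NOT summit progress. [this work] -/
theorem isolation_closed_four_mod_six_sharp : ∀ n : ℕ, n % 6 = 4 → 22 ≤ n → ∀ f g : (Fin n → Bool) → Bool,
    IsDegLeFun 3 f → IsDegLeFun 3 g → 1 - (1 / 2 : ℝ) ^ (n / 3) ≤ forrelation f g → forrelation f g = 1 := by
  intro n hn h22 f g hf hg hΦ
  obtain ⟨r, hr⟩ : ∃ r, n = (3 * r + 2) + (3 * r + 2) := ⟨n / 6, by omega⟩
  subst hr
  have e : ((3 * r + 2) + (3 * r + 2)) / 3 = 2 * r + 1 := by omega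
  rw [e] at hΦ
  exact f2_isolation_ge r (by omega) f g hf hg hΦ

/-- **`θ_n < 1 − 2^{−⌊n/3⌋}` for every `n ≡ 4 (mod 6)`, `n ≥ 22`.** NOT summit progress. [this work] -/
theorem theta_lt_sharp_four_mod_six (n : ℕ) (hn : n % 6 = 4) (h22 : 22 ≤ n) :
    ∃ θ : ℝ, θ < 1 - (1 / 2 : ℝ) ^ (n / 3) ∧ ∀ f g : (Fin n → Bool) → Bool, IsDegLeFun 3 f → IsDegLeFun 3 g →
      θ < forrelation f g → forrelation f g = 1 :=
  fb_theta_lt_of_closed (n := n) _ (isolation_closed_four_mod_six_sharp n hn h22)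

/-- **`θ_n ∈ [15/16, 1 − 2^{−⌊n/3⌋})` for every `n ≡ 4 (mod 6)`, `n ≥ 22`.** NOT summit progress. [this work] -/
theorem theta_halfopen_four_mod_six_sharp (n : ℕ) (hn : n % 6 = 4) (h22 : 22 ≤ n) :
    ∃ θ₀ : ℝ, 15 / 16 ≤ θ₀ ∧ θ₀ < 1 - (1 / 2 : ℝ) ^ (n / 3) ∧
      IsLeast {θ : ℝ | ∀ f g : (Fin n → Bool) → Bool, IsDegLeFun 3 f → IsDegLeFun 3 g →
        θ < forrelation f g → forrelation f g = 1} θ₀ := by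
  obtain ⟨θ₀, hθ₀⟩ := theta_exists n
  obtain ⟨θ', hθ', hiso⟩ := theta_lt_sharp_four_mod_six n hn h22
  have hev : Even n := ⟨n / 2, by omega⟩
  exact ⟨θ₀, le_of_isolates_ge_sixteen hev (by omega) hθ₀.1, lt_of_le_of_lt (hθ₀.2 hiso) hθ', hθ₀⟩

/-! ### Explicit new rows: `n = 22` and `n = 28` -/

/-- **On 22 bits, `Φ ≥ 127/128 ⇒ Φ = 1`** for all cubic `f, g : 𝔽₂²² → 𝔽₂ (the tree had `255/256`, `isolation_rate_closed`).  A decidable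
verdict about the finite slice `n = 22`; NOT summit progress. [this work] -/
theorem isolation_twentytwo_closed : ∀ f g : (Fin 22 → Bool) → Bool, IsDegLeFun 3 f → IsDegLeFun 3 g →
    (127 / 128 : ℝ) ≤ forrelation f g → forrelation f g = 1 := by
  intro f g hf hg hΦ
  exact isolation_closed_four_mod_six_sharp 22 (by norm_num) (by norm_num) f g hf hg (by norm_num; exact hΦ)

/-- **`θ₂₂ ∈ [15/16, 127/128)`.** NOT summit progress. [this work] -/
theorem theta_twentytwo_halfopen : ∃ θ₀ : ℝ, 15 / 16 ≤ θ₀ ∧ θ₀ < 127 / 128 ∧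
    IsLeast {θ : ℝ | ∀ f g : (Fin 22 → Bool) → Bool, IsDegLeFun 3 f → IsDegLeFun 3 g →
      θ < forrelation f g → forrelation f g = 1} θ₀ := by
  obtain ⟨θ₀, h1, h2, h3⟩ := theta_halfopen_four_mod_six_sharp 22 (by norm_num) (by norm_num)
  exact ⟨θ₀, h1, by norm_num at h2; exact h2, h3⟩

/-- **On 28 bits, `Φ ≥ 511/512 ⇒ Φ = 1`** for all cubic `f, g : 𝔽₂²⁸ → 𝔽₂ (the tree had `1023/1024`).  NOT summit progress. [this work] -/
theorem isolation_twentyeight_closed : ∀ f g : (Fin 28 → Bool) → Bool, IsDegLeFun 3 f → IsDegLeFun 3 g →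
    (511 / 512 : ℝ) ≤ forrelation f g → forrelation f g = 1 := by
  intro f g hf hg hΦ
  exact isolation_closed_four_mod_six_sharp 28 (by norm_num) (by norm_num) f g hf hg (by norm_num; exact hΦ)

/-! ### Union over the residue classes `0` and `4 (mod 6)` -/

/-- **For every `n ≥ 16` with `n ≡ 0` or `n ≡ 4 (mod 6)` and all cubic `f, g : 𝔽₂ⁿ → 𝔽₂: `Φ(f,g) ≥ 1 − 2^{−⌊n/3⌋} ⇒ Φ(f,g) = 1`.**
(`n = 16`: `isolation_sixteen_closed`; `n ≡ 0`: `isolation_closed_zero_mod_six_sharp`; `n ≡ 4`, `n ≥ 22`: `isolation_closed_four_mod_six_sharp`.)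
Infinitely many finite-slice verdicts; NOT summit progress (the constants tend to `1`). [this work] -/
theorem isolation_closed_sharp_zero_or_four_mod_six : ∀ n : ℕ, (n % 6 = 0 ∨ n % 6 = 4) → 16 ≤ n → ∀ f g : (Fin n → Bool) → Bool,
    IsDegLeFun 3 f → IsDegLeFun 3 g → 1 - (1 / 2 : ℝ) ^ (n / 3) ≤ forrelation f g → forrelation f g = 1 := by
  intro n hn h16 f g hf hg hΦ
  rcases hn with h0 | h4
  · exact isolation_closed_zero_mod_six_sharp n h0 (by omega) f g hf hg hΦ
  · by_cases h16' : n = 16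
    · subst h16'
      exact isolation_sixteen_closed f g hf hg (by norm_num at hΦ; exact hΦ)
    · exact isolation_closed_four_mod_six_sharp n h4 (by omega) f g hf hg hΦ

/-- **`θ_n < 1 − 2^{−⌊n/3⌋}` for every `n ≥ 16` with `n ≡ 0` or `4 (mod 6)`.** NOT summit progress. [this work] -/
theorem theta_lt_sharp_zero_or_four_mod_six (n : ℕ) (hn : n % 6 = 0 ∨ n % 6 = 4) (h16 : 16 ≤ n) :
    ∃ θ : ℝ, θ < 1 - (1 / 2 : ℝ) ^ (n / 3) ∧ ∀ f g : (Fin n → Bool) → Bool, IsDegLeFun 3 f → IsDegLeFun 3 g →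
      θ < forrelation f g → forrelation f g = 1 :=
  fb_theta_lt_of_closed (n := n) _ (isolation_closed_sharp_zero_or_four_mod_six n hn h16)

end Summit.QuantumAdvantage.QuantumAdvantage.Theorems.CubicForrelation.NearExactIsExact

end
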